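import Literature.Barriers.RiemannHypothesis.BerryKeatingOperator
import Literature.NumberTheory.LFunctions.SelbergArgOmegaProofs
import Literature.NumberTheory.LFunctions.RiemannSiegelStirling
import HarnessLib

/-!
# Barrier: a level sequence within bounded distance of the smooth Riemann–von Mangoldt count is not the zeta spectrum — `S(T)` is unbounded in both directions (Selberg 1946)

Barrier catalogue `Literature/Barriers/RiemannHypothesis/` (D-0021), entry `BoundedFluctuationCounting`
(namespace `Literature.Barriers.RiemannHypothesis`; the catalogued declaration is
`BoundedFluctuationCounting`, PROVED unconditionally as `BoundedFluctuationCounting_holds` from the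
tree's theorem `Literature.NumberTheory.LFunctions.Selberg1946_zetaArgS_omega_holds`).

Filed by the 2026-08-16 barrier audit of `BerryKeatingOperator(Proofs)` (D-0021): the two counting
entries of the catalogue (`BerryKeatingOperator`/`BerryKeatingOperatorNarrow`: linear Weyl laws;
`ScalingSystemCounting`: power laws) compare LEADING DENSITIES only, and the audit recorded the
published spectra that match the leading density of the zeros and therefore evade them — the
modified `xp` Hamiltonians `x(p + ℓ_p²/p)`, `(x + ℓ_x²/x)(p + ℓ_p²/p)` ("its spectrum coincides with
the average Riemann zeros", `n(E) ≃ (E/2π)(log(E/2π) − 1) + O(1)` for `ℓ_xℓ_p = 2π`) and the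
rescaled Egger né Endres–Steiner infinite quantum graph (`N_ES(T)/N_ζ(T) → 1`). This entry is the
obstruction those spectra actually meet: not the density but the FLUCTUATION of the zero count.

## The technique (spectra from a smooth quantisation condition)

A level sequence `E₁ ≤ E₂ ≤ …` produced by a one-freedom (Bohr–Sommerfeld / WKB-exact) quantisation
condition `F(E_n) = n + c`, or by a separable / integrable system, has a counting function
`N(T) = #{n : E_n ≤ T}` that stays within a bounded distance of the smooth function `F`. For the
`xp`-programme the smooth function is tuned to the Riemann–von Mangoldt smooth count
`W(T) = (T/2π) log(T/2π) − T/2π + 7/8` (`rvmSmoothCount`): Sierra–Rodríguez-Laguna's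
`x(p + ℓ_p²/p)` ("If `h = 2πħ` and `ϑ = 5π/4`, one recovers the semiclassical estimates for
`N(E)`"; with `ϑ = π/4` the eigenvalue condition is asymptotically that of Pólya's "fake" `Ξ*`,
`cos((t/2) log(t/2πe) + 7π/8) = 0`, whose zeros "agree in average" with the zeta zeros, PRL p. 4),
Berry–Keating's compact `(x + ℓ_x²/x)(p + ℓ_p²/p)` (Sierra 2019 §5 (49)), and — one-sidedly — the
rescaled divisor graph, `N_ES(T) = D(T/2π) ≥ W(T) − 7/8` (Dirichlet's lower bound).

## The obstruction (what this file vendors) — PROVED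

`N_ζ(T) = θ(T)/π + 1 + S(T)` (Backlund's form; the tree's DEFINITION of
`S = Literature.NumberTheory.LFunctions.zetaArgS`), `θ(T)/π + 1 = W(T) + O(1/T)` (Stirling for `θ`,
`Literature.NumberTheory.LFunctions.abs_riemannSiegelTheta_sub_stirling_le`), and "Selberg [31]
showed that, independently of any unproven hypotheses, `S(t) = Ω±((log t)^{1/3}/(log log t)^{7/3})`"
(Trudgian, §4.4 (41); the tree's `Selberg1946_zetaArgS_omega_holds`, proved there via Tsang 1986
and Selberg's zero-density theorem), so `S` is unbounded below AND above on every half-line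
(`Selberg1946_zetaArgS_omega.unbounded_below/above`). Hence (`BoundedFluctuationCounting_holds`):

* if `N(T) ≥ W(T) − B` for all large `T`, then `N_ζ(T) < N(T)` for arbitrarily large `T`;
* if `N(T) ≤ W(T) + B` for all large `T`, then `N(T) < N_ζ(T)` for arbitrarily large `T`;

in particular no `N` with `|N − W|` eventually bounded agrees with `N_ζ` from any point on
(`BoundedFluctuationCounting.not_eventuallyEq`), e.g. `N(T) = ⌊W(T) + c⌋`
(`BoundedFluctuationCounting.floor`), and the Egger né Endres–Steiner count exceeds `N_ζ`
infinitely often (`frequently_zetaZeroCount_lt_esGraphCount`) although `N_ES/N_ζ → 1`.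

## References

* [TrudgianGram2011] T. Trudgian, *On the success and failure of Gram's Law and the Rosser Rule*,
  Acta Arith. 148 (2011) 225–256 — §4.4 eq. (41) p. 241 (read: "Selberg [31] showed that,
  independently of any unproven hypotheses, `S(t) = Ω±((log t)^{1/3}/(log log t)^{7/3})`").
* [Selberg1946] A. Selberg, *Contributions to the theory of the Riemann zeta-function*, Arch. Math.
  Naturvid. 48 (1946) — the `Ω` theorem, via the tree (`SelbergArgOmega.lean`,
  `SelbergArgOmegaProofs.lean`); [Tsang1986] for the proof route formalised there.
* [Edwards1974] H. M. Edwards, *Riemann's Zeta Function*, §9.8 (Bohr–Landau: on RH `S` is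
  unbounded; note to the 2nd printing: "Selberg proved that `S(t)` is unbounded"), §6.5 (Stirling
  for `θ`) — as cited by the tree files consumed here.
* [SierraRodriguezLaguna2011] G. Sierra, J. Rodríguez-Laguna, PRL 106 (2011) 200201;
  arXiv:1102.5356 — abstract, pp. 3–4 (read).
* [Sierra2019] G. Sierra, Symmetry 11 (2019) 494 — §5 (42)–(49) and summary (read).
* [BerryKeating2011] M. V. Berry, J. P. Keating, J. Phys. A 44 (2011) 285203 (via [Sierra2019] (49)).
* [EggerSteiner2011] S. Egger né Endres, F. Steiner, J. Phys. A 44 (2011) 185202; arXiv:1104.1364 —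
  abstract, §1 p. 3, §4 p. 10 (read); counting function formalised in
  `BerryKeatingOperator.lean` (`esGraphCount`, `le_divisorSummatory`).

## Design notes

* `rvmSmoothCount T = T/(2π) · log(T/(2π)) − T/(2π) + 7/8` is the smooth Riemann–von Mangoldt
  count; `θ(T)/π + 1 − rvmSmoothCount T = (θ(T) − Stirling(T))/π`, bounded by `2K(¼)/(πT)` for
  `T ≥ 2` (`abs_thetaTerm_sub_rvmSmoothCount_le`), so hypotheses may be stated against either.
* Conclusions are `∃ᶠ T in atTop, …` ("for arbitrarily large `T`"); hypotheses `∀ᶠ T in atTop, …`.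
* The lemmas take Selberg's theorem as a hypothesis `(h : Selberg1946_zetaArgS_omega)` and are then
  discharged with `Selberg1946_zetaArgS_omega_holds`, so the catalogued theorem is unconditional
  (net fact debt of this file: `0`).
* Deliberately NOT here: rates. Selberg's rate gives more (`N − W` must oscillate with amplitude
  `≫ (log T)^{1/3}(log log T)^{−7/3}` in both directions), and on RH Bohr–Landau give
  `(log T)^{1/2−ε}`; only boundedness is used, which is what the smooth-quantisation spectra offer.
-/

noncomputable section

open Filter Topology

namespace Literature.Barriers.RiemannHypothesis

open Literature.NumberTheory.LFunctions (zetaZeroCount zetaArgS riemannSiegelTheta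
  Selberg1946_zetaArgS_omega Selberg1946_zetaArgS_omega_holds stirlingVertRate
  abs_riemannSiegelTheta_sub_stirling_le)

/-! ## The smooth Riemann–von Mangoldt count and Backlund's decomposition -/

/-- The smooth Riemann–von Mangoldt counting function `W(T) = (T/2π) log(T/2π) − T/2π + 7/8`
(Titchmarsh Thm. 9.3–9.4 with Stirling for `θ`; Edwards §6.5: `N(T) ≈ θ(T)/π + 1`).
[cite: Titchmarsh1986, Thm. 9.4] -/
def rvmSmoothCount (T : ℝ) : ℝ :=
  T / (2 * Real.pi) * Real.log (T / (2 * Real.pi)) - T / (2 * Real.pi) + 7 / 8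

/-- Backlund's decomposition `N_ζ(T) = θ(T)/π + 1 + S(T)` — the tree's definition of `S`.
[folklore] -/
theorem zetaZeroCount_eq_thetaTerm_add_zetaArgS (T : ℝ) :
    (zetaZeroCount T : ℝ) = riemannSiegelTheta T / Real.pi + 1 + zetaArgS T := by
  simp only [zetaArgS]
  ring

/-- `θ(T)/π + 1 − W(T) = (θ(T) − Stirling main term)/π`, so by the explicit Stirling bound for `θ`
it is at most `2K(¼)/(πT)` in absolute value for `T ≥ 2`. [cite: Edwards1974, §6.5 (6.5.3)] -/
theorem abs_thetaTerm_sub_rvmSmoothCount_le {T : ℝ} (hT : 2 ≤ T) :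
    |riemannSiegelTheta T / Real.pi + 1 - rvmSmoothCount T| ≤
      2 * stirlingVertRate (1 / 4) / T / Real.pi := by
  have hπ : 0 < Real.pi := Real.pi_pos
  have h := abs_riemannSiegelTheta_sub_stirling_le hT
  have e : riemannSiegelTheta T / Real.pi + 1 - rvmSmoothCount T =
      (riemannSiegelTheta T - (T / 2 * Real.log (T / (2 * Real.pi)) - T / 2 - Real.pi / 8)) /
        Real.pi := by
    simp only [rvmSmoothCount]
    field_simp
    ring
  rw [e, abs_div, abs_of_pos hπ]
  exact div_le_div_of_nonneg_right h hπ.le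

/-- A uniform bound: for `T ≥ 2`, `|θ(T)/π + 1 − W(T)| ≤ K(¼)/π` (`K(¼) = 1/6 + π/12 + 5/32 > 0`).
[cite: Edwards1974, §6.5 (6.5.3)] -/
theorem abs_thetaTerm_sub_rvmSmoothCount_le_const {T : ℝ} (hT : 2 ≤ T) :
    |riemannSiegelTheta T / Real.pi + 1 - rvmSmoothCount T| ≤
      stirlingVertRate (1 / 4) / Real.pi := by
  have hπ : 0 < Real.pi := Real.pi_pos
  have hK : 0 ≤ stirlingVertRate (1 / 4) := by
    simp only [stirlingVertRate]
    positivity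
  refine (abs_thetaTerm_sub_rvmSmoothCount_le hT).trans ?_
  rw [div_le_div_iff_of_pos_right hπ, div_le_iff₀ (by linarith)]
  nlinarith [mul_nonneg hK (sub_nonneg.2 hT)]

/-! ## `S` unbounded in both directions ⇒ frequent strict comparisons -/

/-- From Selberg's `Ω₋`: `S(T) < C` for arbitrarily large `T`, for every `C`.
[cite: TrudgianGram2011, §4.4 (41)] -/
theorem frequently_zetaArgS_lt (h : Selberg1946_zetaArgS_omega) (C : ℝ) :
    ∃ᶠ T in atTop, zetaArgS T < C :=
  frequently_atTop.2 fun T ↦ h.unbounded_below C T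

/-- From Selberg's `Ω₊`: `C < S(T)` for arbitrarily large `T`, for every `C`.
[cite: TrudgianGram2011, §4.4 (41)] -/
theorem frequently_lt_zetaArgS (h : Selberg1946_zetaArgS_omega) (C : ℝ) :
    ∃ᶠ T in atTop, C < zetaArgS T :=
  frequently_atTop.2 fun T ↦ h.unbounded_above C T

/-- **Lower-bounded fluctuation ⇒ `N` exceeds `N_ζ` infinitely often** (θ-form). If
`N(T) ≥ θ(T)/π + 1 − B` for all large `T`, then `N_ζ(T) < N(T)` for arbitrarily large `T`.
[cite: TrudgianGram2011, §4.4 (41)] -/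
theorem frequently_zetaZeroCount_lt_of_thetaTerm_sub_le (h : Selberg1946_zetaArgS_omega)
    {N : ℝ → ℝ} {B : ℝ} (hN : ∀ᶠ T in atTop, riemannSiegelTheta T / Real.pi + 1 - B ≤ N T) :
    ∃ᶠ T in atTop, (zetaZeroCount T : ℝ) < N T := by
  refine (frequently_zetaArgS_lt h (-B)).mp (hN.mono fun T hT hS ↦ ?_)
  rw [zetaZeroCount_eq_thetaTerm_add_zetaArgS]
  linarith

/-- **Upper-bounded fluctuation ⇒ `N` falls below `N_ζ` infinitely often** (θ-form). If
`N(T) ≤ θ(T)/π + 1 + B` for all large `T`, then `N(T) < N_ζ(T)` for arbitrarily large `T`.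
[cite: TrudgianGram2011, §4.4 (41)] -/
theorem frequently_lt_zetaZeroCount_of_le_thetaTerm_add (h : Selberg1946_zetaArgS_omega)
    {N : ℝ → ℝ} {B : ℝ} (hN : ∀ᶠ T in atTop, N T ≤ riemannSiegelTheta T / Real.pi + 1 + B) :
    ∃ᶠ T in atTop, N T < (zetaZeroCount T : ℝ) := by
  refine (frequently_lt_zetaArgS h B).mp (hN.mono fun T hT hS ↦ ?_)
  rw [zetaZeroCount_eq_thetaTerm_add_zetaArgS]
  linarith

/-- The same with the smooth count `W` in place of `θ/π + 1` (lower side).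
[cite: TrudgianGram2011, §4.4 (41)] -/
theorem frequently_zetaZeroCount_lt_of_rvmSmoothCount_sub_le (h : Selberg1946_zetaArgS_omega)
    {N : ℝ → ℝ} {B : ℝ} (hN : ∀ᶠ T in atTop, rvmSmoothCount T - B ≤ N T) :
    ∃ᶠ T in atTop, (zetaZeroCount T : ℝ) < N T := by
  refine frequently_zetaZeroCount_lt_of_thetaTerm_sub_le h
    (B := B + stirlingVertRate (1 / 4) / Real.pi) ?_
  filter_upwards [hN, eventually_ge_atTop (2 : ℝ)] with T hT hT2
  have hθ := (abs_le.1 (abs_thetaTerm_sub_rvmSmoothCount_le_const hT2)).2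
  linarith

/-- The same with the smooth count `W` in place of `θ/π + 1` (upper side).
[cite: TrudgianGram2011, §4.4 (41)] -/
theorem frequently_lt_zetaZeroCount_of_le_rvmSmoothCount_add (h : Selberg1946_zetaArgS_omega)
    {N : ℝ → ℝ} {B : ℝ} (hN : ∀ᶠ T in atTop, N T ≤ rvmSmoothCount T + B) :
    ∃ᶠ T in atTop, N T < (zetaZeroCount T : ℝ) := by
  refine frequently_lt_zetaZeroCount_of_le_thetaTerm_add h
    (B := B + stirlingVertRate (1 / 4) / Real.pi) ?_
  filter_upwards [hN, eventually_ge_atTop (2 : ℝ)] with T hT hT2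
  have hθ := (abs_le.1 (abs_thetaTerm_sub_rvmSmoothCount_le_const hT2)).1
  linarith

/-! ## The barrier -/

/-- **Barrier `BoundedFluctuationCounting`** (Selberg 1946 via the Riemann–von Mangoldt–Backlund
decomposition). Let `W(T) = (T/2π) log(T/2π) − T/2π + 7/8` (`rvmSmoothCount`) and
`N_ζ(T) = #{ρ : 0 < Im ρ ≤ T}` with multiplicity (`Literature.NumberTheory.LFunctions.zetaZeroCount`).
For every function `N : ℝ → ℝ` and every `B`: (1) if `W(T) − B ≤ N(T)` for all large `T` then
`N_ζ(T) < N(T)` for arbitrarily large `T`; (2) if `N(T) ≤ W(T) + B` for all large `T` then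
`N(T) < N_ζ(T)` for arbitrarily large `T`. So a level sequence whose counting function stays within
a bounded distance of the smooth Riemann–von Mangoldt count — from above, from below, or both — is
not the sequence of zeta ordinates from any point on. PROVED (`BoundedFluctuationCounting_holds`).

BARRIER (structured block, D-0021):
- technique_class: Hilbert-Polya-by-smooth-quantisation-condition Bohr-Sommerfeld-WKB-exact-spectra one-freedom-integrable-spectra modified-xp-Hamiltonians x(p+l_p^2/p) Berry-Keating-compact-xp Polya-fake-zeta-zeros Gram-points-as-zeros mean-density-matching-spectra bounded-S(T) infinite-quantum-graph-divisor-spectrum counting-function-within-O(1)-of-Riemann-von-Mangoldt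
- blocks: identifying the zeta ordinates (counting function `Literature.NumberTheory.LFunctions.zetaZeroCount`) from some point on with ANY level sequence whose counting function `N` satisfies `N(T) ≥ W(T) − B` eventually (then `N_ζ < N` infinitely often) or `N(T) ≤ W(T) + B` eventually (then `N < N_ζ` infinitely often), `W(T) = (T/2π) log(T/2π) − T/2π + 7/8`; in particular every spectrum `F(E_n) = n + c` of a smooth quantisation condition with `F − W` bounded — the self-adjoint modified `xp` Hamiltonians `x(p + ℓ_p²/p)` on `x ≥ ℓ_x` and `(x + ℓ_x²/x)(p + ℓ_p²/p)` with `ℓ_xℓ_p = 2π` ("its spectrum coincides with the average Riemann zeros", `n(E) ≃ (E/2π)(log(E/ℓ_xℓ_p) − 1) − 1/2`) [cite: SierraRodriguezLaguna2011, abstract and p. 4] [cite: Sierra2019, §5 (42)–(49)] [cite: BerryKeating2011, abstract], Pólya's fake zeros (zeros of `Ξ*`, "agree in average") [cite: SierraRodriguezLaguna2011, p. 4], `N(T) = ⌊W(T) + c⌋` (`BoundedFluctuationCounting.floor`) — and, one-sidedly, the rescaled Egger né Endres–Steiner divisor graph `N_ES = D(T/2π) ≥ W − 7/8` (`frequently_zetaZeroCount_lt_esGraphCount`),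 which evades the density entries `BerryKeatingOperatorNarrow`/`ScalingSystemCounting` (`N_ES/N_ζ → 1`) [cite: EggerSteiner2011, abstract and §1 p. 3]
- because: `N_ζ(T) = θ(T)/π + 1 + S(T)` (Backlund; definition of `Literature.NumberTheory.LFunctions.zetaArgS`), `|θ(T)/π + 1 − W(T)| ≤ 2K(¼)/(πT)` for `T ≥ 2` (Stirling for `θ`, tree theorem `abs_riemannSiegelTheta_sub_stirling_le`) [cite: Edwards1974, §6.5 (6.5.3)], and Selberg's unconditional `S(t) = Ω±((log t)^{1/3}/(log log t)^{7/3})` (tree theorem `Literature.NumberTheory.LFunctions.Selberg1946_zetaArgS_omega_holds`), so `S < −B′` and `S > B′` each hold at arbitrarily large `T` [cite: TrudgianGram2011, §4.4 (41)] [cite: Selberg1946, Ω-theorem for S(t)]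
- evasions_known: none for bounded fluctuation; to carry the zeros a model must produce an UNBOUNDED, prime-correlated fluctuation `N − W` (of size `S(T)`: mean square `(1/2π²) log log T`, `Ω±((log T)^{1/3}(log log T)^{−7/3})`) — attempted by putting arithmetic into the boundary phase, e.g. Sierra's massless Dirac fermion in Rindler space with `δ`-potentials ("moving mirrors") at `ρ = √n`, whose self-adjoint extension is "tuned to the phase of the zeta function … in order to obtain the Riemann zeros as bound states … in the limit where the potentials vanish" (heuristic; the limit is not controlled) [cite: Sierra2019, abstract, §10–§12] [cite: Sierra2014, abstract]
- status: established (theorem; PROVED here, unconditional)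
- scope_caveats: only boundedness of `N − W` on ONE side is used, nothing about rates (Selberg's and, on RH, Bohr–Landau's `(log T)^{1/2−ε}` [cite: Edwards1974, §9.8] would quantify the required oscillation); the entry compares counting functions only — the operators of the blocked models (modified `xp`, graphs) are cited, not formalised, and that their counts are `W + O(1)` is the printed asymptotics (45)–(48), not a tree theorem [cite: Sierra2019, §5 (45)–(48)]; finite windows and `λ`-families are untouched exactly as for the density entries (`exists_hasLinearWeylLaw_eq_zetaZeroCount_of_le` in `BerryKeatingOperatorProofs.lean`); the general Hilbert–Pólya programme (`Literature/Analysis/UnboundedOperators/HilbertPolya.lean`) is untouched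

[cite: TrudgianGram2011, §4.4 (41)] [cite: Selberg1946, Ω-theorem for S(t)] -/
def BoundedFluctuationCounting : Prop :=
  ∀ (N : ℝ → ℝ) (B : ℝ),
    ((∀ᶠ T in atTop, rvmSmoothCount T - B ≤ N T) → ∃ᶠ T in atTop, (zetaZeroCount T : ℝ) < N T) ∧
      ((∀ᶠ T in atTop, N T ≤ rvmSmoothCount T + B) → ∃ᶠ T in atTop, N T < (zetaZeroCount T : ℝ))

/-- The barrier from Selberg's `Ω±` theorem. [cite: TrudgianGram2011, §4.4 (41)] -/
theorem BoundedFluctuationCounting_of_selberg (h : Selberg1946_zetaArgS_omega) :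
    BoundedFluctuationCounting :=
  fun _N _B ↦ ⟨frequently_zetaZeroCount_lt_of_rvmSmoothCount_sub_le h,
    frequently_lt_zetaZeroCount_of_le_rvmSmoothCount_add h⟩

/-- **The barrier holds unconditionally** (the tree proves Selberg's `Ω±` theorem,
`Literature.NumberTheory.LFunctions.Selberg1946_zetaArgS_omega_holds`).
[cite: TrudgianGram2011, §4.4 (41)] [cite: Tsang1986, Thm 3 and §3] -/
theorem BoundedFluctuationCounting_holds : BoundedFluctuationCounting :=
  BoundedFluctuationCounting_of_selberg Selberg1946_zetaArgS_omega_holds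

/-! ## Consequences -/

/-- Two-sided form: if `|N − W| ≤ B` eventually then `N` is infinitely often strictly above and
infinitely often strictly below `N_ζ`. [cite: TrudgianGram2011, §4.4 (41)] -/
theorem BoundedFluctuationCounting.of_abs_sub_le (hB : BoundedFluctuationCounting) {N : ℝ → ℝ}
    {B : ℝ} (hN : ∀ᶠ T in atTop, |N T - rvmSmoothCount T| ≤ B) :
    (∃ᶠ T in atTop, (zetaZeroCount T : ℝ) < N T) ∧ ∃ᶠ T in atTop, N T < (zetaZeroCount T : ℝ) :=
  ⟨(hB N B).1 (hN.mono fun T hT ↦ by linarith [(abs_le.1 hT).1]),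
    (hB N B).2 (hN.mono fun T hT ↦ by linarith [(abs_le.1 hT).2])⟩

/-- In particular such an `N` does not agree with `N_ζ` from any point on (one-sided boundedness
already suffices; here the upper side). [cite: TrudgianGram2011, §4.4 (41)] -/
theorem BoundedFluctuationCounting.not_eventuallyEq (hB : BoundedFluctuationCounting) {N : ℝ → ℝ}
    {B : ℝ} (hN : ∀ᶠ T in atTop, N T ≤ rvmSmoothCount T + B) :
    ¬ ∀ᶠ T in atTop, N T = zetaZeroCount T := by
  intro hEq
  obtain ⟨T, hlt, heq⟩ := (((hB N B).2 hN).and_eventually hEq).exists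
  exact hlt.ne heq

/-- The lower-side version of `BoundedFluctuationCounting.not_eventuallyEq`.
[cite: TrudgianGram2011, §4.4 (41)] -/
theorem BoundedFluctuationCounting.not_eventuallyEq' (hB : BoundedFluctuationCounting) {N : ℝ → ℝ}
    {B : ℝ} (hN : ∀ᶠ T in atTop, rvmSmoothCount T - B ≤ N T) :
    ¬ ∀ᶠ T in atTop, N T = zetaZeroCount T := by
  intro hEq
  obtain ⟨T, hlt, heq⟩ := (((hB N B).1 hN).and_eventually hEq).exists
  exact hlt.ne' heq

/-- **Smooth quantisation, the model case.** The count `N(T) = ⌊W(T) + c⌋` of the level sequence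
defined by `W(E_n) + c = n` (Pólya's fake zeros for `c = 1/2`: `(t/2π) log(t/2πe) + 7/8 = n − 1/2`;
the `ℓ_xℓ_p = 2π` modified-`xp` spectra up to `O(1/E)`) is infinitely often above and infinitely
often below `N_ζ`. [cite: SierraRodriguezLaguna2011, p. 4] -/
theorem BoundedFluctuationCounting.floor (hB : BoundedFluctuationCounting) (c : ℝ) :
    (∃ᶠ T in atTop, (zetaZeroCount T : ℝ) < ⌊rvmSmoothCount T + c⌋) ∧
      ∃ᶠ T in atTop, (⌊rvmSmoothCount T + c⌋ : ℝ) < (zetaZeroCount T : ℝ) := by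
  refine hB.of_abs_sub_le (N := fun T ↦ (⌊rvmSmoothCount T + c⌋ : ℝ)) (B := |c| + 1)
    (Eventually.of_forall fun T ↦ ?_)
  have h1 := Int.floor_le (rvmSmoothCount T + c)
  have h2 := Int.lt_floor_add_one (rvmSmoothCount T + c)
  rw [abs_le]
  rcases abs_cases c with ⟨h3, h4⟩ | ⟨h3, h4⟩ <;> constructor <;> linarith

/-- **The density evasion is closed by the fluctuation barrier.** The rescaled Egger né
Endres–Steiner count `N_ES(T) = D(T/2π)` (`esGraphCount`), which matches the zeta density
(`N_ES/N_ζ → 1`, `tendsto_esGraphCount_div_zetaZeroCount`), satisfies Dirichlet's lower bound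
`N_ES(T) ≥ (T/2π) log(T/2π) − T/2π = W(T) − 7/8` (`le_divisorSummatory`), hence exceeds `N_ζ(T)`
for arbitrarily large `T`. [cite: EggerSteiner2011, §1 p. 3 and §4 p. 10] -/
theorem frequently_zetaZeroCount_lt_esGraphCount :
    ∃ᶠ T in atTop, (zetaZeroCount T : ℝ) < esGraphCount T := by
  refine (BoundedFluctuationCounting_holds esGraphCount (7 / 8)).1 ?_
  filter_upwards [eventually_ge_atTop (2 * Real.pi)] with T hT
  have h2π : 0 < 2 * Real.pi := by positivity
  have hx : 1 ≤ T / (2 * Real.pi) := (one_le_div h2π).2 hT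
  have hD := le_divisorSummatory hx
  simp only [rvmSmoothCount, esGraphCount]
  linarith

end Literature.Barriers.RiemannHypothesis
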